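import Mathlib
import Summits.Ventures.PercRepro.TriangleCapSecondBestParity

/-!
# PercRepro — THE CLOSED FORM IS EVEN ON EVERY CELL, HENCE THE SECOND-BEST VALUE OF THE CHERRY TABLE THREE BELOW THE
DIAGONAL ON EVERY ROW, AND THE TABLE ON EVERY CELL WITH `r ≤ 3` (p3, gen 45; part 199)

`Σ_v d(v)²` is even on every graph (part 197i), and the closed form `m k − r (k − 1 − r)` is even on EVERY cell
`(k, a, r)`: `m k + r k = a (k − a) k` is even and `r (k − 1 − r) + r + r² = r k` with `r² + r` even
(`closed_form_parity_gap`: a non-extremal `K₄⁻`-free graph on the cell is at least `2` below). At `r = 3` the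
broom (part 186, `broom_value`) is exactly `2 (r − 2) = 2` below, so THE SECOND-BEST VALUE of `Σ_v d(v)²` over the
non-extremal `K₄⁻`-free graphs on `Fin k` with `a (k − a) − 3` edges is EXACTLY `m k − 3 (k − 4) − 2` on every
row `a ≥ 4` with `2a + 3 ≤ k` (`three_below_second_best_gen`; the row `a = 3` is part 190's
`three_row_second_best`, `secondGapThree k 3 = 2`). `second_best_table''`: the second-best value of the cherry
table on EVERY cell with `r ≤ 3` — `secondGap k a r` of part 197h, which is `2` for every `r ≥ 2`. Axioms:
standard.
-/

namespace PercRepro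

namespace TriangleCap

namespace C047

open Finset

variable {V : Type*} [Fintype V] [DecidableEq V]

/-- `r (k − 1 − r) + r + r · r = r k` for `r + 1 ≤ k`. -/
theorem closed_form_term_arith (k r : ℕ) (hr : r + 1 ≤ k) : r * (k - 1 - r) + r + r * r = r * k := by
  obtain ⟨t, rfl⟩ : ∃ t, k = r + 1 + t := ⟨k - (r + 1), by omega⟩
  have e : r + 1 + t - 1 - r = t := by omega
  rw [e]
  ring

/-- **THE CLOSED FORM IS EVEN — A NON-EXTREMAL GRAPH IS AT LEAST `2` BELOW:** `K₄⁻`-free, `3 ≤ a`, `2a + r ≤ k`,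
`m + r = a (k − a)`, `Σ_v d(v)² + r (k − 1 − r) ≠ m k` ⇒ `Σ_v d(v)² + r (k − 1 − r) + 2 ≤ m k`. -/
theorem closed_form_parity_gap (D : SimpleGraph V) [DecidableRel D.Adj] (hK : K4mFree D) (a r : ℕ) (ha : 3 ≤ a)
    (hk : 2 * a + r ≤ Fintype.card V) (hm : D.edgeFinset.card + r = a * (Fintype.card V - a))
    (hne : ∑ v, deg D v * deg D v + r * (Fintype.card V - 1 - r) ≠ D.edgeFinset.card * Fintype.card V) :
    ∑ v, deg D v * deg D v + r * (Fintype.card V - 1 - r) + 2 ≤ D.edgeFinset.card * Fintype.card V := by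
  have hle := closed_form_stability D hK a r ha hk
    (below_cap_arith a (Fintype.card V) D.edgeFinset.card r (by omega) hm)
  obtain ⟨p, hp⟩ := even_sum_deg_sq D
  obtain ⟨q, hq⟩ : Even (D.edgeFinset.card * Fintype.card V + r * Fintype.card V) := by
    have h1 := even_mul_sub_mul a (Fintype.card V) (by omega)
    have h2 : D.edgeFinset.card * Fintype.card V + r * Fintype.card V =
        a * (Fintype.card V - a) * Fintype.card V := by
      rw [← add_mul, hm]
    rw [h2]
    exact h1
  obtain ⟨s, hs⟩ : Even (r * r + r) := by
    have : r * r + r = r * (r + 1) := by ring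
    rw [this]
    exact Nat.even_mul_succ_self r
  have ht := closed_form_term_arith (Fintype.card V) r (by omega)
  omega

/-- **THE SECOND-BEST VALUE THREE BELOW THE DIAGONAL, EVERY ROW `a ≥ 4`:** for `2a + 3 ≤ k`, every non-extremal
`K₄⁻`-free graph on `Fin k` with `a (k − a) − 3` edges has `Σ_v d(v)² + 3 (k − 4) + 2 ≤ m k`, and the value is
attained (the broom: `K_{a,k−a}` minus three pairs that are not a star). -/
theorem three_below_second_best_gen (k a : ℕ) (ha : 4 ≤ a) (hk : 2 * a + 3 ≤ k) :
    (∀ (D : SimpleGraph (Fin k)) [DecidableRel D.Adj], K4mFree D → D.edgeFinset.card + 3 = a * (k - a) →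
        ∑ v, deg D v * deg D v + 3 * (k - 4) ≠ D.edgeFinset.card * k →
        ∑ v, deg D v * deg D v + 3 * (k - 4) + 2 ≤ D.edgeFinset.card * k) ∧
      ∃ (D : SimpleGraph (Fin k)) (_ : DecidableRel D.Adj), K4mFree D ∧ D.edgeFinset.card + 3 = a * (k - a) ∧
        ∑ v, deg D v * deg D v + 3 * (k - 4) + 2 = D.edgeFinset.card * k := by
  have hcard : Fintype.card (Fin k) = k := Fintype.card_fin k
  have e : k - 1 - 3 = k - 4 := by omega
  refine ⟨?_, ?_⟩
  · intro D _ hK hm hne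
    have h := closed_form_parity_gap D hK a 3 (by omega) (by rw [hcard]; exact hk) (by rw [hcard]; exact hm)
      (by rw [hcard, e]; exact hne)
    rw [hcard, e] at h
    exact h
  · obtain ⟨D, inst, A, hK, -, -, -, hE, hS⟩ := broom_value k a 3 (by omega) (le_refl 3) (by omega)
    have hpos : 3 ≤ a * (k - a) := by
      have : 3 ≤ (k - a) := by omega
      calc 3 ≤ 1 * 3 := by norm_num
        _ ≤ a * (k - a) := Nat.mul_le_mul (by omega) this
    refine ⟨D, inst, hK, by omega, ?_⟩
    rw [e] at hS
    have e2 : 2 * (3 - 2) = 2 := by norm_num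
    rw [e2] at hS
    rw [hS, hE]

/-- **THE SECOND-BEST VALUE OF THE CHERRY TABLE ON EVERY CELL WITH `r ≤ 3`:** for `3 ≤ a`, `r ≤ 3`, `2a + 2 ≤ k`
(`2a + 3 ≤ k` at `r = 3`), `r + 7 ≤ k` on the row `a = 3`: every non-extremal `K₄⁻`-free graph on `Fin k` with
`a (k − a) − r` edges has `Σ_v d(v)² + r (k − 1 − r) + secondGap k a r ≤ m k`, and the value is attained. -/
theorem second_best_table'' (k a r : ℕ) (ha : 3 ≤ a) (hr : r ≤ 3) (hk : 2 * a + 2 ≤ k) (hk3 : a = 3 → r + 7 ≤ k)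
    (hkr : r = 3 → 2 * a + 3 ≤ k) :
    (∀ (D : SimpleGraph (Fin k)) [DecidableRel D.Adj], K4mFree D → D.edgeFinset.card + r = a * (k - a) →
        ∑ v, deg D v * deg D v + r * (k - 1 - r) ≠ D.edgeFinset.card * k →
        ∑ v, deg D v * deg D v + r * (k - 1 - r) + secondGap k a r ≤ D.edgeFinset.card * k) ∧
      ∃ (D : SimpleGraph (Fin k)) (_ : DecidableRel D.Adj), K4mFree D ∧ D.edgeFinset.card + r = a * (k - a) ∧
        ∑ v, deg D v * deg D v + r * (k - 1 - r) + secondGap k a r = D.edgeFinset.card * k := by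
  rcases Nat.lt_or_ge r 3 with hr2 | hr3
  · exact second_best_table' k a r ha (by omega) hk hk3
  have hr3' : r = 3 := by omega
  subst hr3'
  have hgap : secondGap k a 3 = 2 := by simp [secondGap]
  rw [hgap]
  rcases Nat.lt_or_ge a 4 with ha3 | ha4
  · -- the row `a = 3`: part 190
    have ha3' : a = 3 := by omega
    subst ha3'
    have hk7 := hk3 rfl
    obtain ⟨h1, D, inst, hK, hE, hS⟩ := three_row_second_best k 3 (by norm_num) hk7
    have hgap3 : secondGapThree k 3 = 2 := by simp [secondGapThree]
    rw [hgap3] at h1 hS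
    have hcell : ∀ m : ℕ, m + 3 = 3 * (k - 3) ↔ m + 9 + 3 = 3 * k := by
      intro m
      have : 3 * (k - 3) + 9 = 3 * k := by omega
      omega
    refine ⟨fun D _ hK hm hne => h1 D hK ((hcell _).mp hm) hne, D, inst, hK, (hcell _).mpr hE, hS⟩
  · exact three_below_second_best_gen k a ha4 (hkr rfl)

end C047

end TriangleCap

end PercRepro
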